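import Summits.KontsevichZagierPeriods.KontsevichZagierPeriods.Theses.HurwitzMicroSectors
import Summits.KontsevichZagierPeriods.KontsevichZagierPeriods.Theorems.HurwitzMicroSectorsNormalFormPrinciplePiBoxTransfer
import Summits.KontsevichZagierPeriods.KontsevichZagierPeriods.Theorems.HurwitzMicroSectorsNormalFormPrincipleVariants2222
import Summits.KontsevichZagierPeriods.KontsevichZagierPeriods.Theorems.HurwitzMicroSectorsNormalFormPrincipleVariants2215

/-! TTRL-lite variant V2253 of stmt-KontsevichZagierPeriods-3869

Variant V2253 = `stub_boxRigidity` (the leaf `BoxRigidity` of `NormalFormPrinciple`: two representations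
on open unit boxes with integrands of KZ's rational shape `p/q`, `p, q` over `ℚ`, and equal values are
KZ-equivalent) under the TWO-sided small-case move `fix_nat:m=3; bound_nat:m'≤5` (left dimension frozen
to `3`, right dimension `≤ 5`). Verdict of the attempt seat: **open** — this file is the exact-strength
certificate, not a proof of the variant. Writing `BoxVanishing K` for "every box-rational representation
on `(0,1)^K` of value `0` is a relation", a two-sided freeze/bound of the leaf is worth exactly
`BoxVanishing D` for the LARGEST dimension `D` it allows (here `D = max 3 5 = 5`):
* `V2253 ⟺ BoxVanishing 5` (`stub_boxRigidity_var2253_iff_boxVanishing_five`): (⇒) compare a vanishing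
  `5`-dimensional representation with the zero representation on the `3`-box
  (`boxVanishingDim_right_of_pair 3 5`, file `…Variants2238`); (⇐) pad both representations to the
  `5`-box and subtract there (`boxRigidityLe_of_boxVanishingDim 5`, same file);
* hence `V2253 ⟺ BoxRigidity for all m, m' ≤ 5` (`stub_boxRigidity_var2253_iff_le_five`), and V2253
  coincides with BOTH of its nearest siblings: V2252 (`fix_nat:m=3; fix_nat:m'=5` — the bound `m' ≤ 5`
  may be frozen to `m' = 5`, `stub_boxRigidity_var2253_iff_var2252`) and V2222
  (`fix_nat:m=2; bound_nat:m'≤5` — the frozen left dimension is idle once it is `≤ 5`,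
  `stub_boxRigidity_var2253_iff_var2222`); it gives `BoxVanishing j` for every `j ≤ 5`
  (`boxVanishing_le_five_of_stub_boxRigidity_var2253`).
Why open: V2253 contains, UNCONDITIONALLY, Conjecture 1 on every weight-`5` box sector
`P(t)/(1 − t^k)`, `t = x₀x₁x₂x₃x₄` (`sectorFiveLevel_of_stub_boxRigidity_var2253`; `k = 1`: values in
`ℚ + ℚζ(5)`, and for the pair `[1/(1 − t)]` (value `ζ(5)`) versus a rational constant `[q]` the premise is
`ζ(5) = q` — in the tree's only mechanism (reduction–rigidity) the rigidity input of this instance is the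
irrationality of `ζ(5)`, open). The tree closes box sectors only with a linear-independence THEOREM as
input (Baker in dimension `1`: `boxRigidity_of_le_one`; Apéry on the `(3,2)` sector; Calegari–Dimitrov–Tang
on `(2,6)`), and no such theorem exists in dimension `5`. Conversely `KontsevichZagierPeriods → V2253`
(`stub_boxRigidity_var2253_of_statement`), so a refutation of the variant would refute the Summit: the
variant is neither provable nor refutable from the tree.
Source: M. Kontsevich, D. Zagier, *Periods* (2001), §1.2 Conjecture 1. Pure proof file, no definitions. -/

-- `Summit.<Summit>.<Problem>` is the tree's mandated summit-side namespace (CONVENTIONS §2); for this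
-- single-conjunct summit the two coincide, so the duplicate is deliberate.
set_option linter.dupNamespace false

noncomputable section

namespace Summit.KontsevichZagierPeriods.KontsevichZagierPeriods.Theorems

open MeasureTheory Set
open Literature.NumberTheory.Transcendental Literature.NumberTheory.Transcendental.KZ
open Summit.KontsevichZagierPeriods.KontsevichZagierPeriods.Theses.HurwitzMicroSectors
open Summit.KontsevichZagierPeriods.HurwitzMicroSectors.NormalFormPrinciple.PiBox

/-! ## The variant V2253 itself: exactly `BoxVanishing 5` -/

/-- **V2253 ⟺ `BoxVanishing 5`**: (⇒) the pair of dimensions `(3, 5)` is allowed (`5 ≤ 5`), so a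
vanishing box-rational representation on `(0,1)⁵` is KZ-equivalent to the zero representation on the
`3`-box, itself a relation (`boxVanishingDim_right_of_pair 3 5`); (⇐) `boxRigidityLe_of_boxVanishingDim 5`
with `m = 3 ≤ 5`, `m' ≤ 5`. [cite: KontsevichZagier2001, §1.2 Conjecture 1] -/
theorem stub_boxRigidity_var2253_iff_boxVanishing_five :
    (∀ (m' : ℕ) (N : IntegralRep 3) (N' : IntegralRep m'), m' ≤ 5 → N.domain = {x | ∀ i, x i ∈ Set.Ioo (0:ℝ) 1} → N.IsRational → N'.domain = {x | ∀ i, x i ∈ Set.Ioo (0:ℝ) 1} → N'.IsRational → N.value = N'.value → Equivalent N N') ↔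
    (∀ (M : IntegralRep 5), M.domain = {x | ∀ i, x i ∈ Set.Ioo (0:ℝ) 1} → M.IsRational →
      M.value = 0 → of M ∈ relations) :=
  ⟨fun h => boxVanishingDim_right_of_pair 3 5 fun N N' => h 5 N N' le_rfl,
    fun hvan m' N N' hm' => boxRigidityLe_of_boxVanishingDim 5 hvan 3 m' N N' (by norm_num) hm'⟩

/-- **V2253 ⟺ `BoxRigidity` for all `m, m' ≤ 5`** (so V2253 coincides with the joint variant
`bound_nat:m≤5; bound_nat:m'≤5` and with every `fix/bound` sibling of maximum dimension `5`).
[cite: KontsevichZagier2001, §1.2 Conjecture 1] -/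
theorem stub_boxRigidity_var2253_iff_le_five :
    (∀ (m' : ℕ) (N : IntegralRep 3) (N' : IntegralRep m'), m' ≤ 5 → N.domain = {x | ∀ i, x i ∈ Set.Ioo (0:ℝ) 1} → N.IsRational → N'.domain = {x | ∀ i, x i ∈ Set.Ioo (0:ℝ) 1} → N'.IsRational → N.value = N'.value → Equivalent N N') ↔
    (∀ (m m' : ℕ) (N : IntegralRep m) (N' : IntegralRep m'), m ≤ 5 → m' ≤ 5 →
      N.domain = {x | ∀ i, x i ∈ Set.Ioo (0:ℝ) 1} → N.IsRational →
      N'.domain = {x | ∀ i, x i ∈ Set.Ioo (0:ℝ) 1} → N'.IsRational →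
      N.value = N'.value → Equivalent N N') := by
  rw [stub_boxRigidity_var2253_iff_boxVanishing_five]
  exact ⟨fun hvan => boxRigidityLe_of_boxVanishingDim 5 hvan,
    fun h => boxVanishingDim_left_of_pair 5 5 fun N N' => h 5 5 N N' le_rfl le_rfl⟩

/-- **V2253 ⟺ the sibling V2252** (`fix_nat:m=3; fix_nat:m'=5`, file `…Variants2252`): both are
`BoxVanishing 5` (for V2252 this is `boxRigidityFix_iff_boxVanishing_snd`, file `…Variants2215`) — the
bound `m' ≤ 5` loses nothing when frozen to `m' = 5`, the smaller right dimensions being idle.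
[cite: KontsevichZagier2001, §1.2 Conjecture 1] -/
theorem stub_boxRigidity_var2253_iff_var2252 :
    (∀ (m' : ℕ) (N : IntegralRep 3) (N' : IntegralRep m'), m' ≤ 5 → N.domain = {x | ∀ i, x i ∈ Set.Ioo (0:ℝ) 1} → N.IsRational → N'.domain = {x | ∀ i, x i ∈ Set.Ioo (0:ℝ) 1} → N'.IsRational → N.value = N'.value → Equivalent N N') ↔
    (∀ (N : IntegralRep 3) (N' : IntegralRep 5), N.domain = {x | ∀ i, x i ∈ Set.Ioo (0:ℝ) 1} → N.IsRational → N'.domain = {x | ∀ i, x i ∈ Set.Ioo (0:ℝ) 1} → N'.IsRational → N.value = N'.value → Equivalent N N') :=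
  stub_boxRigidity_var2253_iff_boxVanishing_five.trans
    (boxRigidityFix_iff_boxVanishing_snd (by norm_num)).symm

/-- **V2253 ⟺ the sibling V2222** (`fix_nat:m=2; bound_nat:m'≤5`): both are `BoxVanishing 5` — the
frozen left dimension (`3` or `2`) is idle once it is at most the right bound `5`.
[cite: KontsevichZagier2001, §1.2 Conjecture 1] -/
theorem stub_boxRigidity_var2253_iff_var2222 :
    (∀ (m' : ℕ) (N : IntegralRep 3) (N' : IntegralRep m'), m' ≤ 5 → N.domain = {x | ∀ i, x i ∈ Set.Ioo (0:ℝ) 1} → N.IsRational → N'.domain = {x | ∀ i, x i ∈ Set.Ioo (0:ℝ) 1} → N'.IsRational → N.value = N'.value → Equivalent N N') ↔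
    (∀ (m' : ℕ) (N : IntegralRep 2) (N' : IntegralRep m'), m' ≤ 5 → N.domain = {x | ∀ i, x i ∈ Set.Ioo (0:ℝ) 1} → N.IsRational → N'.domain = {x | ∀ i, x i ∈ Set.Ioo (0:ℝ) 1} → N'.IsRational → N.value = N'.value → Equivalent N N') :=
  stub_boxRigidity_var2253_iff_boxVanishing_five.trans
    stub_boxRigidity_var2222_iff_boxVanishing_five.symm

/-- **V2253 ⇒ `BoxVanishing j` for every `j ≤ 5`** (monotonicity in the dimension: pad by unit
intervals). [cite: KontsevichZagier2001, §1.2 Conjecture 1] -/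
theorem boxVanishing_le_five_of_stub_boxRigidity_var2253
    (h : ∀ (m' : ℕ) (N : IntegralRep 3) (N' : IntegralRep m'), m' ≤ 5 → N.domain = {x | ∀ i, x i ∈ Set.Ioo (0:ℝ) 1} → N.IsRational → N'.domain = {x | ∀ i, x i ∈ Set.Ioo (0:ℝ) 1} → N'.IsRational → N.value = N'.value → Equivalent N N')
    {j : ℕ} (hj : j ≤ 5) (N : IntegralRep j) (hNd : N.domain = {x | ∀ i, x i ∈ Set.Ioo (0:ℝ) 1})
    (hNr : N.IsRational) (hv : N.value = 0) : of N ∈ relations :=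
  boxVanishingDim_mono hj (stub_boxRigidity_var2253_iff_boxVanishing_five.1 h) N hNd hNr hv

/-- **The parent leaf ⇒ V2253** (specialisation; the converse is not claimed — the parent is
`BoxVanishing` in ALL dimensions, the variant only in dimension `5`).
[cite: KontsevichZagier2001, §1.2 Conjecture 1] -/
theorem stub_boxRigidity_var2253_of_parent
    (h : ∀ (m m' : ℕ) (N : IntegralRep m) (N' : IntegralRep m'), N.domain = {x | ∀ i, x i ∈ Set.Ioo (0:ℝ) 1} → N.IsRational → N'.domain = {x | ∀ i, x i ∈ Set.Ioo (0:ℝ) 1} → N'.IsRational → N.value = N'.value → Equivalent N N') :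
    ∀ (m' : ℕ) (N : IntegralRep 3) (N' : IntegralRep m'), m' ≤ 5 → N.domain = {x | ∀ i, x i ∈ Set.Ioo (0:ℝ) 1} → N.IsRational → N'.domain = {x | ∀ i, x i ∈ Set.Ioo (0:ℝ) 1} → N'.IsRational → N.value = N'.value → Equivalent N N' :=
  fun m' N N' _ => h 3 m' N N'

/-- **`KontsevichZagierPeriods ⇒ V2253`**: the variant is a special case of Conjecture 1 for the tree's
calculus (`leaves_of_statement`) — so a refutation of the variant would refute the Summit.
[cite: KontsevichZagier2001, §1.2 Conjecture 1] -/
theorem stub_boxRigidity_var2253_of_statement (h : _root_.KontsevichZagierPeriods) :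
    ∀ (m' : ℕ) (N : IntegralRep 3) (N' : IntegralRep m'), m' ≤ 5 → N.domain = {x | ∀ i, x i ∈ Set.Ioo (0:ℝ) 1} → N.IsRational → N'.domain = {x | ∀ i, x i ∈ Set.Ioo (0:ℝ) 1} → N'.IsRational → N.value = N'.value → Equivalent N N' :=
  stub_boxRigidity_var2253_of_parent (leaves_of_statement h).1

/-! ## What the variant contains unconditionally: the weight-five box sectors -/

/-- **V2253 ⇒ Conjecture 1 on EVERY weight-`5` box sector `P(t)/(1 − t^k)`, `t = x₀x₁x₂x₃x₄`,
unconditionally** (`k ≠ 0`). For `k = 1` the values lie in `ℚ + ℚζ(5)`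
(`∫_{(0,1)⁵} t^j/(1 − t) = ζ(5) − H_j^{(5)}`), so for the pair `[1/(1 − t)]` (value `ζ(5)`) and a rational
constant `[q]` the premise is `ζ(5) = q`: in the tree's only mechanism (reduction–rigidity) the rigidity
input of this instance is the irrationality of `ζ(5)` — open. This is the sharpest reason the seat
records V2253 as open rather than provable. [cite: KontsevichZagier2001, §1.2 Conjecture 1] -/
theorem sectorFiveLevel_of_stub_boxRigidity_var2253
    (h : ∀ (m' : ℕ) (N : IntegralRep 3) (N' : IntegralRep m'), m' ≤ 5 → N.domain = {x | ∀ i, x i ∈ Set.Ioo (0:ℝ) 1} → N.IsRational → N'.domain = {x | ∀ i, x i ∈ Set.Ioo (0:ℝ) 1} → N'.IsRational → N.value = N'.value → Equivalent N N')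
    (k : ℕ) (hk : k ≠ 0) :
    ∀ (r r' : IntegralRep 5) (P P' : Polynomial ℚ), r.domain = {x | ∀ i, x i ∈ Set.Ioo (0:ℝ) 1} →
      r'.domain = {x | ∀ i, x i ∈ Set.Ioo (0:ℝ) 1} →
      Set.EqOn r.integrand (fun x => Polynomial.aeval (x 0 * x 1 * x 2 * x 3 * x 4) P /
        (1 - (x 0 * x 1 * x 2 * x 3 * x 4) ^ k)) r.domain →
      Set.EqOn r'.integrand (fun x => Polynomial.aeval (x 0 * x 1 * x 2 * x 3 * x 4) P' /
        (1 - (x 0 * x 1 * x 2 * x 3 * x 4) ^ k)) r'.domain →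
      r.value = r'.value → Equivalent r r' :=
  fun r r' P P' hrd hr'd hri hr'i hv =>
    (stub_boxRigidity_var2253_iff_le_five.1 h) 5 5 r r' le_rfl le_rfl hrd
      (isRational_of_eqOn_sectorFive k hk r P hrd hri) hr'd
      (isRational_of_eqOn_sectorFive k hk r' P' hr'd hr'i) hv

end Summit.KontsevichZagierPeriods.KontsevichZagierPeriods.Theorems

end
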